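import Summits.HodgeConjecture.HodgeConjecture.Cruxes.BlochSeedDiscOne.DepthBoundA4

/-!
# IntegralityGap — what MEMO-12 («RATIONAL DESIGNS EXIST») leaves of the depth-bound line, as typed statements
(plan-lens-HodgeAV-strengthen g8; token: line stmt-HodgeConjecture-18881 Cruxes/BlochSeedDiscOne/Lines/birth.lean 814a6a70c14e831a stub_rung_pad4_seedAt)

EVIDENCE-LEVEL CONTEXT (machine-exact, verifier-checked, NOT kernel; files `pub/ideators/plan-lens-HodgeAV-strengthen/memo-12/`):
explicit rational solutions of the (A1) ∧ (A4) ∧ μ ≠ 0 system on the height-14 alphabet exist at (copies, rank) = (40, 8) and (199, 8)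
(`D077-B40`, `D077-B199`, `D455-B199`); multiplied by the lcm `L` of their denominators they are honest `Design`s. Hence the
SCALED non-existence statement `ScaledNonex 14 40 8` below is (at evidence level) FALSE, while `Nonex 14 199 8` — the conjunction
`DepthBound 14 199 8 3 ∧ RingsEmpty 14 199 8 3` of `DepthBoundA4` — stays open: it is an INTEGRALITY statement. This file types the
three integrality-aware forms the S⁺ ledger v1.11 keeps (rows #80–#82) and proves the bookkeeping reductions between them in the kernel:
support length ≤ copies, `Nonex ← SparseNonex`, `Nonex ← KTops 95`, `Nonex ← ScaledNonex`, monotonicity. Nothing here is a rung;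
nothing is proved toward HC ∕ HC_CM ∕ HC_AV ∕ №4 ∕ 26512 ∕ 18881 ∕ H2. No `sorry`, no new axioms, Mathlib + `DepthBoundA4` only.
-/

namespace Summit.HodgeConjecture.HodgeConjecture.Cruxes.BlochSeedDiscOne.IntegralityGap

open Summit.HodgeConjecture.HodgeConjecture.Cruxes.BlochSeedDiscOne.DepthBoundA4

/-- NONEX(h, B, rmin): no (A1)-clean (A4) design with `μ ≠ 0`, copies `≤ B`, rank `≥ rmin` on the height-`h` alphabet
(= the conclusion of `a4_closed_of_depthBound_and_rings`). -/
def Nonex (h : ℤ) (B : ℕ) (rmin : ℤ) : Prop :=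
  ∀ D : Design, D.OnAlphabet h → D.A1 → D.A4 → D.mu ≠ 0 → D.copies ≤ B → rmin ≤ D.rank → False

theorem nonex_of_depthBound_and_rings (h : ℤ) (B : ℕ) (rmin c₀ : ℤ)
    (hd : DepthBound h B rmin c₀) (hr : RingsEmpty h B rmin c₀) : Nonex h B rmin :=
  a4_closed_of_depthBound_and_rings h B rmin c₀ hd hr

theorem nonex_mono {h : ℤ} {B B' : ℕ} {rmin rmin' : ℤ} (hB : B ≤ B') (hr : rmin' ≤ rmin)
    (hn : Nonex h B' rmin') : Nonex h B rmin :=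
  fun D hA h1 h4 hμ hc hrk => hn D hA h1 h4 hμ (le_trans hc hB) (le_trans hr hrk)

/-- SCALED NONEX = non-existence over ℚ: for every scale `L ≥ 1`, no design with copies `≤ L·B` and rank `≥ L·rmin`.
A rational solution of the (A1) ∧ (A4)-support ∧ μ ≠ 0 system at `(B, rmin)` times the lcm of its denominators is exactly a
counterexample to this; MEMO-12's `D077-B40` is one for `(h, B, rmin) = (14, 40, 8)` (evidence level). -/
def ScaledNonex (h : ℤ) (B : ℕ) (rmin : ℤ) : Prop :=
  ∀ L : ℕ, 0 < L → Nonex h (L * B) ((L : ℤ) * rmin)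

theorem nonex_of_scaledNonex {h : ℤ} {B : ℕ} {rmin : ℤ} (hs : ScaledNonex h B rmin) : Nonex h B rmin := by
  have := hs 1 one_pos
  simpa using this

theorem scaledNonex_mono {h : ℤ} {B B' : ℕ} {rmin : ℤ} (hB : B ≤ B') (hs : ScaledNonex h B' rmin) :
    ScaledNonex h B rmin :=
  fun L hL => nonex_mono (Nat.mul_le_mul_left L hB) le_rfl (hs L hL)

/-- MEMO-12 F3 as a typed NEGATIVE statement (evidence level; the kernel replay of the 569-cell witness is not attempted here). -/
def RationalDesignsExist : Prop := ¬ ScaledNonex 14 40 8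

/-- … which would a fortiori refute the scaled form of the budget of record. -/
theorem not_scaledNonex_199_of (h : RationalDesignsExist) : ¬ ScaledNonex 14 199 8 :=
  fun hs => h (scaledNonex_mono (by norm_num) hs)

/-! ## Support counting: the integrality lever -/

theorem length_filter_le_sum (l : List (Cell × ℕ)) :
    (l.filter fun cm => 0 < cm.2).length ≤ (l.map Prod.snd).sum := by
  induction l with
  | nil => simp
  | cons cm l ih =>
      obtain ⟨c, m⟩ := cm
      by_cases hm : 0 < m
      · simp [hm]
        omega
      · simp [hm]
        omega

theorem length_filterMap_le_sum (l : List (Cell × ℕ)) :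
    ((l.filter fun cm => 0 < cm.2).map Prod.fst).length ≤ (l.map Prod.snd).sum := by
  rw [List.length_map]
  exact length_filter_le_sum l

/-- Every support cell costs at least one copy. -/
theorem length_supp_le_copies (D : Design) : (D.suppN ++ D.suppP).length ≤ D.copies := by
  simp only [List.length_append, Design.suppN, Design.suppP, Design.copies]
  exact Nat.add_le_add (length_filterMap_le_sum D.N) (length_filterMap_le_sum D.P)

theorem length_suppP_le (D : Design) : D.suppP.length ≤ (D.P.map Prod.snd).sum :=
  length_filterMap_le_sum D.P

/-- SPARSE-NONEX(h, s; B, rmin): no (A1) ∧ (A4) ∧ μ ≠ 0 design supported on `≤ s` cells with rank ∕ copies `≥ rmin ∕ B`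
(scale-free: invariant under multiplying all masses by `L`). S⁺ ledger v1.11 row #81; open for `(14, 199; 199, 8)`;
the rational witnesses of MEMO-12 need 560–726 ordered cells. -/
def SparseNonex (h : ℤ) (s : ℕ) (B : ℕ) (rmin : ℤ) : Prop :=
  ∀ D : Design, D.OnAlphabet h → D.A1 → D.A4 → D.mu ≠ 0 → (D.suppN ++ D.suppP).length ≤ s →
    rmin * (D.copies : ℤ) ≤ (B : ℤ) * D.rank → False

/-- NONEX(14,199,8) follows from the sparse form with `s = 199`: a design with `≤ 199` copies has `≤ 199` support cells. -/
theorem nonex_of_sparse (hs : SparseNonex 14 199 199 8) : Nonex 14 199 8 := by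
  intro D hA h1 h4 hμ hc hrk
  refine hs D hA h1 h4 hμ (le_trans (length_supp_le_copies D) hc) ?_
  have hc' : (D.copies : ℤ) ≤ 199 := by exact_mod_cast hc
  have h199 : ((199 : ℕ) : ℤ) = 199 := by norm_num
  rw [h199]
  omega

/-- K-TOPS(k): no (A1) ∧ (A4) ∧ μ ≠ 0 design at `(199, 8)` whose P-support has `≤ k` cells (the brief's «≤ k distinct tops»;
S⁺ ledger row #82: relaxation proxy TRUE for k = 1, FALSE for k = 9). -/
def KTops (k : ℕ) : Prop :=
  ∀ D : Design, D.OnAlphabet 14 → D.A1 → D.A4 → D.mu ≠ 0 → D.copies ≤ 199 → 8 ≤ D.rank → D.suppP.length ≤ k → False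

theorem kTops_mono {k k' : ℕ} (hk : k ≤ k') (h : KTops k') : KTops k :=
  fun D hA h1 h4 hμ hc hr hP => h D hA h1 h4 hμ hc hr (le_trans hP hk)

/-- The k-induction need only reach `k = 95`: `Σ_P m = (copies − rank)/2 ≤ (199 − 8)/2`. -/
theorem nonex_of_kTops (h : KTops 95) : Nonex 14 199 8 := by
  intro D hA h1 h4 hμ hc hrk
  refine h D hA h1 h4 hμ hc hrk ?_
  have hP := length_suppP_le D
  have hc' : (D.N.map Prod.snd).sum + (D.P.map Prod.snd).sum ≤ 199 := hc
  have hr' : (8 : ℤ) ≤ ((D.N.map Prod.snd).sum : ℤ) - ((D.P.map Prod.snd).sum : ℤ) := hrk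
  omega

/-- Conversely the budget form implies every `KTops k`. -/
theorem kTops_of_nonex (h : Nonex 14 199 8) (k : ℕ) : KTops k :=
  fun D hA h1 h4 hμ hc hr _ => h D hA h1 h4 hμ hc hr

end Summit.HodgeConjecture.HodgeConjecture.Cruxes.BlochSeedDiscOne.IntegralityGap
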